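import Summits.RiemannHypothesis.RiemannHypothesis.Theorems.HandoffDodgerSmallProfile
import HarnessLib

/-!
# HANDOFF — FOURTH SLAB (2): the profile-control constants at `y = 28`, `N₁ = 36`, with `η` GENERIC in a horizon floor `Tm` (rh-explicit, W-P(P2) crux 19185, seat dodger-p2 gen0; DODGER-STAGE2-PLAN §2)

RH-FREE. HONEST FRAMING: nothing here bears on the truth of RH; part (2) of the discharge of the hypotheses of
`HandoffDodgerExplicitWindow.dodger_witness_explicit_window` on the fourth slab `7100 ≤ q < 12500` at the CONSTANT schedule
`y = 28`, `N₁ = 36`: `N₁ + 1 ≤ pL/(2W)`, `ρ₁ < 1` (indeed `ρ₁ ≤ 0.8455`), `3τ₁ ≤ 0.0393`, `ρ₂ ≤ 10⁻⁶ ≤ e^{−2}`, `τ₂ ≤ 10⁻⁴`, and the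
profile-control constant `κ ≥ 2 − e^{u₀} − 0.0394` for ANY `u₀` with `73695 ≤ u₀·Tm`, `Tm ≤ T′` (`η ≤ e^{u₀} − 1` from
`2(1/pL + k(T+½)/pL²)·W·N₁² ≤ 73695/T′`), so that the assembly can feed a horizon floor `Tm = 17.04(A−1)` PER SUB-SLAB `[A, X]` — near the
floor of the chain `κ` varies from `0.12` (q = 7100) to `0.48` (q = 12500) and a single slab constant would not close. Numeric sizes of part (1):
`120900 ≤ T′`, `T′² ≤ W ≤ T′² + 1/4`, `k′ ≤ 0.3184·b·T′ ≤ 1.505T′`, `T′³/28.42 ≤ pL`, `b ≤ 4.725`. Also the degree-7 Taylor majorant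
`e^{u} ≤ 1 + u + … + u⁶/720 + u⁷/4410` (`0 ≤ u ≤ 1`) used by the assembly to make `κ₀` a `norm_num` fact.

References: this track (ATTEMPT-16 §3 (D1), ATTEMPT-19 §8, ATTEMPT-21 §3, ATTEMPT-23 §2/§7; HOME/rh-explicit-dodger-p2/DODGER-STAGE2-PLAN.md §2).
-/

set_option linter.dupNamespace false

noncomputable section

open Real

namespace Summit.RiemannHypothesis.RiemannHypothesis.Theorems.Handoff

/-! ## The pieces -/

/-- `ν = k(T+½)/pL ≤ 4·10⁻⁴` on the fourth slab. [this track, ATTEMPT-23 §7] -/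
theorem nu_le_slabFour {T k pL : ℝ} (hT : 120900 ≤ T) (hk : k ≤ 1.505 * T) (hpL : T ^ 3 / 28.42 ≤ pL) :
    k * (T + 1 / 2) / pL ≤ 4 / 10000 := by
  have hT0 : 0 < T := by linarith
  have hpL0 : 0 < pL := lt_of_lt_of_le (by positivity) hpL
  rw [div_le_iff₀ hpL0]
  have h1 : k * (T + 1 / 2) ≤ 1.505 * T * (1.000005 * T) :=
    mul_le_mul hk (by linarith only [hT]) (by linarith only [hT0]) (by positivity)
  have h4 : T ^ 3 ≤ 28.42 * pL := by rw [div_le_iff₀ (by norm_num)] at hpL; linarith only [hpL]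
  nlinarith only [h1, h4, hT, sq_nonneg T, hT0]

/-- `37 ≤ pL/(2W)` on the fourth slab. [this track, ATTEMPT-23 §7] -/
theorem N_le_slabFour {T pL W : ℝ} (hT : 120900 ≤ T) (hW0 : 0 < W) (hW3 : W ≤ T ^ 2 + 1 / 4) (hpL : T ^ 3 / 28.42 ≤ pL) :
    (37 : ℝ) ≤ pL / (2 * W) := by
  have hT0 : 0 < T := by linarith
  rw [le_div_iff₀ (by positivity)]
  have h4 : T ^ 3 ≤ 28.42 * pL := by rw [div_le_iff₀ (by norm_num)] at hpL; linarith only [hpL]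
  nlinarith only [h4, hW3, hT, sq_nonneg T, hT0]

/-- `ρ₁ ≤ 0.8455` at `y = 28`, `N₁ = 36`. [this track, ATTEMPT-23 §7; DODGER-STAGE2-PLAN §2] -/
theorem rho1_le_slabFour {ν lamU ρ1 E y : ℝ} {N₁ : ℕ} (hν0 : 0 ≤ ν) (hν : ν ≤ 4 / 10000) (hlamU : lamU = 1 + ν)
    (hE : E = Real.exp (3 + lamU)) (hy : y = 28) (hN₁ : N₁ = 36)
    (hρ1 : ρ1 = E * (4 * y ^ 2) / (4 * ((N₁ : ℝ) + 1) ^ 3)) : ρ1 ≤ 0.8455 := by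
  have hexp : E ≤ 54.622 := by
    have e1 : 3 + lamU = 4 + ν := by rw [hlamU]; ring
    rw [hE, e1, Real.exp_add]
    have h1 := exp_numerics.2.2.1
    have h2 : Real.exp ν ≤ 1 + ν + ν ^ 2 := by
      have := Real.abs_exp_sub_one_sub_id_le (x := ν) (by rw [abs_of_nonneg hν0]; linarith only [hν])
      have := (abs_le.1 this).2
      linarith only [this]
    have h3 : 1 + ν + ν ^ 2 ≤ 1.00040016 := by nlinarith only [hν, hν0]
    calc Real.exp 4 * Real.exp ν ≤ 54.6 * 1.00040016 :=
          mul_le_mul h1.le (h2.trans h3) (Real.exp_pos _).le (by norm_num)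
      _ ≤ 54.622 := by norm_num
  rw [hρ1, hy, hN₁, div_le_iff₀ (by positivity)]
  push_cast
  nlinarith only [hexp]

/-- `τ₁ ≤ 0.0131` from `ρ₁ ≤ 0.8455` and `N₁ = 36`. [this track, ATTEMPT-23 §7; DODGER-STAGE2-PLAN §2] -/
theorem tau1_le_slabFour {ρ1 τ1 : ℝ} {N₁ : ℕ} (hρ1ge : 0 ≤ ρ1) (hρ1le : ρ1 ≤ 0.8455) (hN₁ : N₁ = 36)
    (hτ1 : τ1 = ρ1 ^ (N₁ + 1) / (1 - ρ1)) : τ1 ≤ 131 / 10000 := by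
  rw [hτ1, hN₁, div_le_iff₀ (by linarith only [hρ1le])]
  have h2 : ρ1 ^ (36 + 1) ≤ (0.8455 : ℝ) ^ (36 + 1) := pow_le_pow_left₀ hρ1ge hρ1le _
  have h3 : (0.8455 : ℝ) ^ (36 + 1) ≤ 202 / 100000 := by norm_num
  nlinarith only [h2, h3, hρ1le]

/-- `ρ₂ ≤ 10⁻⁶` at `y = 28` on the fourth slab. [this track, ATTEMPT-23 §7] -/
theorem rho2_le_slabFour {T pL W ρ2U y : ℝ} (hT : 120900 ≤ T) (hW0 : 0 < W) (hW3 : W ≤ T ^ 2 + 1 / 4)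
    (hpL : T ^ 3 / 28.42 ≤ pL) (hy : y = 28)
    (hρ2U : ρ2U = 8 * Real.exp 2 * W ^ 3 * y ^ 2 / pL ^ 3) : ρ2U ≤ 1 / 10 ^ 6 := by
  have hT0 : 0 < T := by linarith
  have hpL0 : 0 < pL := lt_of_lt_of_le (by positivity) hpL
  rw [hρ2U, hy, div_le_iff₀ (by positivity)]
  have hW2 : W ≤ 1.00001 * T ^ 2 := by nlinarith only [hW3, hT]
  have hW3' : W ^ 3 ≤ (1.00001 * T ^ 2) ^ 3 := pow_le_pow_left₀ hW0.le hW2 3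
  have hp3 : (T ^ 3 / 28.42) ^ 3 ≤ pL ^ 3 := pow_le_pow_left₀ (by positivity) hpL 3
  have e2 := exp_numerics.1
  have h1 : 8 * Real.exp 2 * W ^ 3 * (28 : ℝ) ^ 2 ≤ 8 * 7.39 * (1.00001 * T ^ 2) ^ 3 * 28 ^ 2 := by
    have := mul_le_mul e2.le hW3' (by positivity) (by norm_num)
    nlinarith only [this]
  have h2 : 8 * 7.39 * (1.00001 * T ^ 2) ^ 3 * (28 : ℝ) ^ 2 ≤ 1 / 10 ^ 6 * (T ^ 3 / 28.42) ^ 3 := by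
    have e1 : (T ^ 3 / 28.42) ^ 3 = T ^ 6 * T ^ 3 / 28.42 ^ 3 := by ring
    have e3 : 8 * 7.39 * (1.00001 * T ^ 2) ^ 3 * (28 : ℝ) ^ 2 = 8 * 7.39 * 1.00001 ^ 3 * 28 ^ 2 * T ^ 6 := by ring
    rw [e1, e3]
    have hT3 : (120900 : ℝ) ^ 3 ≤ T ^ 3 := pow_le_pow_left₀ (by norm_num) hT 3
    have hT6 : (0 : ℝ) ≤ T ^ 6 := by positivity
    have key : 8 * 7.39 * 1.00001 ^ 3 * 28 ^ 2 * ((28.42 : ℝ) ^ 3 * 10 ^ 6) ≤ T ^ 3 := le_trans (by norm_num) hT3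
    have hk := mul_le_mul_of_nonneg_left key hT6
    rw [show 1 / 10 ^ 6 * (T ^ 6 * T ^ 3 / 28.42 ^ 3) = T ^ 6 * T ^ 3 / ((28.42 : ℝ) ^ 3 * 10 ^ 6) by ring]
    rw [le_div_iff₀ (by norm_num)]
    nlinarith only [hk]
  nlinarith only [h1, h2, hp3]

/-- `τ₂ ≤ 10⁻⁴` on the fourth slab. [this track, ATTEMPT-23 §7 (same mechanism as gen10's `tau2_le`)] -/
theorem tau2_le_slabFour {T k pL W ρ2U τ2U : ℝ} (hT : 120900 ≤ T) (hk : k ≤ 1.505 * T)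
    (hW1 : T ^ 2 ≤ W) (hW3 : W ≤ T ^ 2 + 1 / 4) (hpL : T ^ 3 / 28.42 ≤ pL)
    (hρ2ge : 0 < ρ2U) (hρ2le : ρ2U ≤ 1 / 10 ^ 6)
    (hτ2U : τ2U = Real.exp (pL / W * (1 + 1 / 2 * Real.log ρ2U) + k * (T + 1 / 2) / (2 * W)) / (1 - ρ2U)) :
    τ2U ≤ 1 / 10000 := by
  have hT0 : 0 < T := by linarith
  have hpL0 : 0 < pL := lt_of_lt_of_le (by positivity) hpL
  have hW0 : 0 < W := lt_of_lt_of_le (by positivity) hW1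
  rw [hτ2U, div_le_iff₀ (by linarith only [hρ2le])]
  have hlog : Real.log ρ2U ≤ -4 := by
    rw [Real.log_le_iff_le_exp hρ2ge]
    refine hρ2le.trans ?_
    rw [Real.exp_neg, le_inv_comm₀ (by norm_num) (Real.exp_pos _)]
    have := exp_numerics.2.2.1
    norm_num; linarith only [this]
  have hpW : T / 28.43 ≤ pL / W := by
    rw [div_le_div_iff₀ (by norm_num) hW0]
    have h4 : T ^ 3 ≤ 28.42 * pL := by rw [div_le_iff₀ (by norm_num)] at hpL; linarith only [hpL]
    nlinarith only [hW3, h4, hpL0, hT, hT0]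
  have hA : pL / W * (1 + 1 / 2 * Real.log ρ2U) ≤ -(T / 28.43) := by
    have h1 : 1 + 1 / 2 * Real.log ρ2U ≤ -1 := by linarith only [hlog]
    have h2 : 0 < pL / W := by positivity
    nlinarith only [h1, h2, hpW]
  have hB : k * (T + 1 / 2) / (2 * W) ≤ 1 := by
    rw [div_le_iff₀ (by positivity)]
    have h1 : k * (T + 1 / 2) ≤ 1.505 * T * (1.000005 * T) :=
      mul_le_mul hk (by linarith only [hT]) (by linarith only [hT0]) (by positivity)
    nlinarith only [h1, hW1]
  have hX : pL / W * (1 + 1 / 2 * Real.log ρ2U) + k * (T + 1 / 2) / (2 * W) ≤ -10 := by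
    have h2 : 11 ≤ T / 28.43 := by rw [le_div_iff₀ (by norm_num)]; linarith only [hT]
    linarith only [hA, hB, h2]
  have hE : Real.exp (pL / W * (1 + 1 / 2 * Real.log ρ2U) + k * (T + 1 / 2) / (2 * W)) ≤ 1 / 20000 := by
    refine (Real.exp_le_exp.2 hX).trans ?_
    rw [Real.exp_neg, inv_le_comm₀ (Real.exp_pos _) (by norm_num)]
    have h10 : Real.exp 10 = Real.exp 4 * Real.exp 4 * Real.exp 2 := by rw [← Real.exp_add, ← Real.exp_add]; norm_num
    rw [h10]; norm_num; nlinarith only [exp_numerics.2.2.2, exp_numerics.2.1, Real.exp_pos 2, Real.exp_pos 4]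
  nlinarith only [hE, hρ2le, Real.exp_pos (pL / W * (1 + 1 / 2 * Real.log ρ2U) + k * (T + 1 / 2) / (2 * W))]

/-- **`η ≤ e^{u₀} − 1`** at `N₁ = 36` on the fourth slab, GENERIC in a horizon floor `Tm ≤ T`: the exponent
`2(1/pL + k(T+½)/pL²)·W·N₁² ≤ 73695/T ≤ u₀` since `pL ≥ T³/28.42`, `W ≤ T² + 1/4`, `ν ≤ 4·10⁻⁴`, `T ≥ 120900`, `73695 ≤ u₀·Tm`.
[this track, ATTEMPT-23 §7; DODGER-STAGE2-PLAN §2] -/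
theorem eta_le_slabFour {T k pL W ηU Tm u₀ : ℝ} {N₁ : ℕ} (hT : 120900 ≤ T) (hTm0 : 0 < Tm) (hTmT : Tm ≤ T) (hk0 : 0 ≤ k)
    (hW0 : 0 < W) (hW3 : W ≤ T ^ 2 + 1 / 4)
    (hpL : T ^ 3 / 28.42 ≤ pL) (hν : k * (T + 1 / 2) / pL ≤ 4 / 10000) (hN₁ : N₁ = 36)
    (hηU : ηU = Real.exp (2 * (1 / pL + k * (T + 1 / 2) / pL ^ 2) * W * (N₁ : ℝ) ^ 2) - 1)
    (hu₀ : 73695 ≤ u₀ * Tm) : ηU ≤ Real.exp u₀ - 1 := by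
  have hT0 : 0 < T := by linarith
  have hpL0 : 0 < pL := lt_of_lt_of_le (by positivity) hpL
  rw [hηU, hN₁]
  push_cast
  set u := 2 * (1 / pL + k * (T + 1 / 2) / pL ^ 2) * W * (36 : ℝ) ^ 2 with hu
  have hinner : 1 / pL + k * (T + 1 / 2) / pL ^ 2 ≤ 10004 / 10000 / pL := by
    have e : 1 / pL + k * (T + 1 / 2) / pL ^ 2 = (1 + k * (T + 1 / 2) / pL) / pL := by
      field_simp
    rw [e]; exact div_le_div_of_nonneg_right (by linarith only [hν]) hpL0.le
  have hu1 : u ≤ 73695 / T := by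
    have h1 : u ≤ 2 * (10004 / 10000 / pL) * (T ^ 2 + 1 / 4) * (36 : ℝ) ^ 2 := by
      rw [hu]
      have a1 : 2 * (1 / pL + k * (T + 1 / 2) / pL ^ 2) * W ≤ 2 * (10004 / 10000 / pL) * (T ^ 2 + 1 / 4) :=
        mul_le_mul (by linarith only [hinner]) hW3 hW0.le (by positivity)
      exact mul_le_mul_of_nonneg_right a1 (by positivity)
    have h2 : 2 * (10004 / 10000 / pL) * (T ^ 2 + 1 / 4) * (36 : ℝ) ^ 2 ≤ 73695 / T := by
      have e : 2 * (10004 / 10000 / pL) * (T ^ 2 + 1 / 4) * (36 : ℝ) ^ 2 =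
          2 * (10004 / 10000) * 36 ^ 2 * (T ^ 2 + 1 / 4) / pL := by
        field_simp
      rw [e, div_le_div_iff₀ hpL0 hT0]
      have h4 : T ^ 3 ≤ 28.42 * pL := by rw [div_le_iff₀ (by norm_num)] at hpL; linarith only [hpL]
      have h6 : (120900 : ℝ) ^ 2 ≤ T ^ 2 := pow_le_pow_left₀ (by norm_num) hT 2
      -- `2·1.0004·1296·(T²+¼)·T ≤ 73695·pL`, using `28.42·pL ≥ T³` and `T² ≥ 120900²`
      nlinarith only [h4, h6, hT0, hpL0]
    linarith only [h1, h2]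
  have hu2 : u ≤ u₀ := by
    have h3 : 73695 / T ≤ 73695 / Tm := div_le_div_of_nonneg_left (by norm_num) hTm0 hTmT
    have h4 : 73695 / Tm ≤ u₀ := by rw [div_le_iff₀ hTm0]; exact hu₀
    linarith only [hu1, h3, h4]
  linarith only [Real.exp_le_exp.2 hu2]

/-- The degree-7 Taylor majorant of the exponential on `[0, 1]`: `e^u ≤ 1 + u + u²/2 + … + u⁶/720 + u⁷/4410`
(`Real.exp_bound'` with `n = 7`). [folklore] -/
theorem exp_le_taylor_seven {u : ℝ} (hu0 : 0 ≤ u) (hu1 : u ≤ 1) :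
    Real.exp u ≤ 1 + u + u ^ 2 / 2 + u ^ 3 / 6 + u ^ 4 / 24 + u ^ 5 / 120 + u ^ 6 / 720 + u ^ 7 / 4410 := by
  have := Real.exp_bound' hu0 hu1 (n := 7) (by norm_num)
  simp only [Finset.sum_range_succ, Finset.sum_range_zero, Nat.factorial] at this
  norm_num at this
  linarith

/-- **Part (2) of the fourth-slab discharge: the profile-control constants at the schedule `y = 28`, `N₁ = 36`, `η` generic.**
`N₁+1 ≤ pL/(2W)`, `ρ₁ < 1`, `ρ₂ ≤ e^{-2}`, and `2 − e^{u₀} − 0.0394 ≤ κ` for any `u₀` with `73695 ≤ u₀·Tm`, `0 < Tm ≤ T`, for the sizes of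
part (1). [this track, ATTEMPT-23 §7; DODGER-STAGE2-PLAN §2] -/
theorem profile_constants_slabFour {b T k pL W y lamU ρ1 ρ2U ηU τ1 τ2U κ Tm u₀ : ℝ} {N₁ : ℕ}
    (hb1 : b ≤ 189 / 40) (hT : 120900 ≤ T) (hTm0 : 0 < Tm) (hTmT : Tm ≤ T) (hW1 : T ^ 2 ≤ W) (hW3 : W ≤ T ^ 2 + 1 / 4)
    (hk0 : 2 ≤ k) (hk : k ≤ 0.3184 * b * T) (hpL : T ^ 3 / 28.42 ≤ pL)
    (hy : y = 28) (hN₁ : N₁ = 36)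
    (hlamU : lamU = 1 + k * (T + 1 / 2) / pL)
    (hρ1 : ρ1 = Real.exp (3 + lamU) * (4 * y ^ 2) / (4 * ((N₁ : ℝ) + 1) ^ 3))
    (hρ2U : ρ2U = 8 * Real.exp 2 * W ^ 3 * y ^ 2 / pL ^ 3)
    (hηU : ηU = Real.exp (2 * (1 / pL + k * (T + 1 / 2) / pL ^ 2) * W * (N₁ : ℝ) ^ 2) - 1)
    (hτ1 : τ1 = ρ1 ^ (N₁ + 1) / (1 - ρ1))
    (hτ2U : τ2U = Real.exp (pL / W * (1 + 1 / 2 * Real.log ρ2U) + k * (T + 1 / 2) / (2 * W)) / (1 - ρ2U))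
    (hκ : κ = 1 - ηU - 3 * τ1 - τ2U) (hu₀ : 73695 ≤ u₀ * Tm) :
    (N₁ : ℝ) + 1 ≤ pL / (2 * W) ∧ ρ1 < 1 ∧ ρ2U ≤ Real.exp (-2) ∧ 2 - Real.exp u₀ - 394 / 10000 ≤ κ := by
  have hT0 : 0 < T := by linarith
  have hW0 : 0 < W := lt_of_lt_of_le (by positivity) hW1
  have hk00 : 0 ≤ k := by linarith only [hk0]
  have hk' : k ≤ 1.505 * T := by nlinarith only [hk, hb1, hT0]
  have hpL0 : 0 < pL := lt_of_lt_of_le (by positivity) hpL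
  have hν := nu_le_slabFour hT hk' hpL
  have hν0 : 0 ≤ k * (T + 1 / 2) / pL := by positivity
  have hN : (N₁ : ℝ) + 1 ≤ pL / (2 * W) := by
    rw [hN₁]; push_cast
    have := N_le_slabFour hT hW0 hW3 hpL
    linarith only [this]
  have hρ1le := rho1_le_slabFour (ν := k * (T + 1 / 2) / pL) hν0 hν hlamU rfl hy hN₁ hρ1
  have hρ1ge : 0 ≤ ρ1 := by rw [hρ1]; positivity
  have hτ1le := tau1_le_slabFour hρ1ge hρ1le hN₁ hτ1
  have hρ2le := rho2_le_slabFour hT hW0 hW3 hpL hy hρ2U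
  have hρ2ge : 0 < ρ2U := by rw [hρ2U, hy]; positivity
  have hρ2e : ρ2U ≤ Real.exp (-2) := by
    refine hρ2le.trans ?_
    rw [Real.exp_neg, le_inv_comm₀ (by norm_num) (Real.exp_pos _)]
    have := exp_numerics.1; norm_num; linarith only [this]
  have hτ2le := tau2_le_slabFour hT hk' hW1 hW3 hpL hρ2ge hρ2le hτ2U
  have hηle := eta_le_slabFour hT hTm0 hTmT hk00 hW0 hW3 hpL hν hN₁ hηU hu₀
  refine ⟨hN, by linarith only [hρ1le], hρ2e, ?_⟩
  rw [hκ]; linarith only [hηle, hτ1le, hτ2le]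

end Summit.RiemannHypothesis.RiemannHypothesis.Theorems.Handoff

end
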